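import Summits.BirchSwinnertonDyer.BirchSwinnertonDyer.Theorems.SoloInformedJointUniform
import Literature.NumberTheory.EllipticCurves.OrdinaryPrimes
import Literature.NumberTheory.EllipticCurves.CanonicalPAdicHeight
import HarnessLib

/-!
# SoloInformedRankZero — the rung `r = 0` of the joint receptacle is the interpolation formula

The joint Gross–Zagier receptacle `(ZZ_r)` (`JointHigherGrossZagier r`, file
`SoloInformedJointGrossZagier`) and its `p`-uniform form `(ZZ_r^u)` (`JointHigherGrossZagierUnif r`,
file `SoloInformedJointUniform`) ask, for `E/ℚ` of analytic rank `r`, for `r` rational points `P`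
and ONE rational constant `c` with `L^{(r)}(E,1)/r! = c · Ω⁺_f · det⟨P_i,P_j⟩_NT` and
`[T^r] L_p(E,T) · (log_p γ)^r = c · (1 - α⁻¹)² · det⟨P_i,P_j⟩_D` at good ordinary `p`.

At `r = 0` both determinants are `1` (empty family) and the two identities are THEOREMS in the
tree: `L(E,1) = [0]⁺_f · Ω⁺_f` (`IsNewformOf.entireLFunction_one_eq`: the rational modular symbol,
Manin–Drinfeld) and `L_p(E,0) = (1 - α⁻¹)² [0]⁺_f` (`constantCoeff_padicLFunction_unitRoot`, the
first clause of the Mazur–Tate–Teitelbaum interpolation property, PROVED in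
`PAdicBSDInterpolationProofs` from the modular-symbol construction of `L_p`). So with
`c = [0]⁺_f = ratPlusSymbol f 0`:

* `soloInformedZero_joint : JointHigherGrossZagier 0` and
  `soloInformedZero_unif : JointHigherGrossZagierUnif 0` — unconditionally;
* `soloInformedZero_rank_eq`: `r_an(E) = 0`, `p ≥ 5` good ordinary ⇒ `rank E(ℚ) = 0`,
  `corank Ш(E/ℚ)[p^∞] = 0`, `ord_T L_p(E,T) = 0` — the joint mechanism `soloInformedJoint_rank_eq`
  with its Schneider-type input VACUOUS (the empty family has `p`-adic regulator `1`), i.e. from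
  interpolation + Kato + modularity alone (the known `r_an = 0` case: Kolyvagin 1988 / Kato 2004,
  Astérisque 295 Cor. 14.3);
* `soloInformedZero_rank_eq_analyticRank_of_zero`: the RANK conjecture at `r_an = 0`, given the
  supply facts (one good ordinary `p ≥ 5`, its canonical datum, the newform) and Kato.

Together with `soloInformedJoint_one_of_perrinRiou` / `soloInformedUnif_one_of_perrinRiou` this
makes the ladder of the receptacle explicit inside the kernel: rung `0` = MTT interpolation
(theorem), rung `1` = Perrin-Riou's `p`-adic Gross–Zagier (theorem in print), rung `2` = open, with
no constructor of the two points in print. The transcendence input of the mechanism is likewise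
graded: vacuous at `r = 0`, Bertrand's theorem at `r = 1` for CM curves
(`SoloInformedCMRankOne`), open at `r = 1` non-CM and at every `r ≥ 2`.
-/

noncomputable section

open scoped Classical MatrixGroups ModularForm

open CongruenceSubgroup Literature.NumberTheory.EllipticCurves
  Literature.NumberTheory.EllipticCurves.ModularForms WeierstrassCurve WeierstrassCurve.Affine.Point
  Matrix

namespace Summit.BirchSwinnertonDyer.BirchSwinnertonDyer.Theorems

/-- The Néron–Tate regulator of the empty family is `1` (determinant of the `0 × 0` matrix).
[folklore] -/
theorem soloInformedZero_regulatorOf_fin_zero {W : WeierstrassCurve ℚ}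
    (P : Fin 0 → W.toAffine.Point) :
    regulatorOf P = 1 := by
  unfold regulatorOf
  convert Matrix.det_isEmpty
  infer_instance

/-- The `p`-adic regulator of the empty family is `1`. [folklore] -/
theorem soloInformedZero_padicRegulatorOf_fin_zero {W : WeierstrassCurve ℚ} {p : ℕ} [Fact p.Prime]
    (D : WeierstrassCurve.PAdicHeightData W p) (P : Fin 0 → W.toAffine.Point) :
    padicRegulatorOf D P = 1 := by
  unfold padicRegulatorOf
  convert Matrix.det_isEmpty
  infer_instance

variable (W : WeierstrassCurve ℚ) [W.IsElliptic] [W.IsGloballyMinimal]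

omit [W.IsGloballyMinimal] in
/-- **Archimedean identity of `(ZZ_0)`.** If `ord_{s=1} L(E,s) = 0` then the leading coefficient is
`L(E,1) = [0]⁺_f · Ω⁺_f = [0]⁺_f · Ω⁺_f · Reg(∅)` (`IsNewformOf.entireLFunction_one_eq`; the empty
regulator is `1`). [cite: MazurTateTeitelbaum1986Invent, §I.14 (14.3)] -/
theorem soloInformedZero_leadingLCoeff_eq (h0 : W.analyticRank = 0) {N : ℕ} [NeZero N]
    (f : CuspForm (Gamma0 N) 2) (hf : IsNewformOf W f) (P : Fin 0 → W.toAffine.Point) :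
    W.leadingLCoeff = ((((ratPlusSymbol f 0 : ℚ) : ℝ) * plusPeriod f * regulatorOf P : ℝ) : ℂ) := by
  have hL : W.leadingLCoeff = W.entireLFunction 1 := by
    rw [WeierstrassCurve.leadingLCoeff, h0]
    simp
  rw [soloInformedZero_regulatorOf_fin_zero, mul_one, hL, hf.entireLFunction_one_eq]

/-- **`p`-adic identity of `(ZZ_0)` = the constant term of the interpolation property.** At a good
ordinary prime `p`, `[T^0] L_p(E,T) · (log_p γ)^0 = [0]⁺_f · (1 - α⁻¹)² · Reg_D(∅)`
(`constantCoeff_padicLFunction_unitRoot`, Mazur–Tate–Teitelbaum 1986 §I.14 (14.3), proved in the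
tree from the modular-symbol measure). [cite: MazurTateTeitelbaum1986Invent, §I.14 (14.3)] -/
theorem soloInformedZero_coeff_zero_eq {p : ℕ} [Fact p.Prime] (hord : IsOrdinaryAt W p)
    (D : WeierstrassCurve.PAdicHeightData W p) {N : ℕ} [NeZero N] (f : CuspForm (Gamma0 N) 2)
    (hf : IsNewformOf W f) (P : Fin 0 → W.toAffine.Point) :
    PowerSeries.coeff 0 (padicLFunction f (unitRoot W p : ℚ_[p])) *
        padicLog p (cyclotomicGenerator p) ^ 0 =
      ((ratPlusSymbol f 0 : ℚ) : ℚ_[p]) * (1 - (unitRoot W p : ℚ_[p])⁻¹) ^ 2 *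
        padicRegulatorOf D P := by
  rw [pow_zero, mul_one, soloInformedZero_padicRegulatorOf_fin_zero, mul_one,
    PowerSeries.coeff_zero_eq_constantCoeff_apply, constantCoeff_padicLFunction_unitRoot hord hf,
    mul_comm]

/-- **Rung `r = 0` of the joint receptacle (THEOREM).** `JointHigherGrossZagier 0` holds: the empty
family and `c = [0]⁺_f`. [cite: MazurTateTeitelbaum1986Invent, §I.14 (14.3)] -/
theorem soloInformedZero_joint : JointHigherGrossZagier 0 := by
  intro W _ _ p _ _ hord h0 D _ N _ f hf
  exact ⟨fun i => i.elim0, ratPlusSymbol f 0, soloInformedZero_leadingLCoeff_eq W h0 f hf _,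
    soloInformedZero_coeff_zero_eq W hord D f hf _⟩

/-- **Rung `r = 0` of the `p`-uniform receptacle (THEOREM).** `JointHigherGrossZagierUnif 0` holds
with ONE `c = [0]⁺_f` for every good ordinary prime — the rational modular symbol does not depend
on `p`. [cite: MazurTateTeitelbaum1986Invent, §I.14 (14.3)] -/
theorem soloInformedZero_unif : JointHigherGrossZagierUnif 0 := by
  intro W _ _ h0 N _ f hf
  exact ⟨fun i => i.elim0, ratPlusSymbol f 0, soloInformedZero_leadingLCoeff_eq W h0 f hf _,
    fun p _ _ hord D _ => soloInformedZero_coeff_zero_eq W hord D f hf _⟩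

/-- **Analytic rank zero: rank, `Ш[p^∞]` and `ord_T L_p` from the joint mechanism.** For `E/ℚ`
(globally minimal `W`) with `ord_{s=1} L(E,s) = 0`, a good ordinary prime `p ≥ 5`, the canonical
datum `D` and the newform `f`: modularity (`L(E,1) ≠ 0` as the leading coefficient) and Kato's
divisibility `corank Sel_{p^∞} ≤ ord_T L_p` give `rank E(ℚ) = 0`, `corank_{ℤ_p} Ш(E/ℚ)[p^∞] = 0`
and `ord_{T=0} L_p(E,T) = 0` — `soloInformedJoint_rank_eq` at `r = 0`, where the `p`-adic
non-degeneracy input is vacuous (`Reg_D(∅) = 1`). Known (Kolyvagin 1988; Kato 2004, Astérisque 295,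
Cor. 14.3); recorded as rung `0` of the receptacle's ladder.
[cite: MazurTateTeitelbaum1986Invent, §I.14 (14.3)] -/
theorem soloInformedZero_rank_eq (hE : hasEntireLFunction_rat) (h0 : W.analyticRank = 0)
    (p : ℕ) [Fact p.Prime] (hp : 5 ≤ p) (hord : IsOrdinaryAt W p)
    (D : WeierstrassCurve.PAdicHeightData W p) (hD : D.IsCanonical)
    {N : ℕ} [NeZero N] (f : CuspForm (Gamma0 N) 2) (hf : IsNewformOf W f)
    (hKato : kato_selmerCorank_le_order_padicLFunction W p (f := f)) :
    W.mordellWeilRank = 0 ∧ W.shaCorank p = 0 ∧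
      (padicLFunction f (unitRoot W p : ℚ_[p])).order = 0 :=
  soloInformedJoint_rank_eq W p f soloInformedZero_joint hE hp hord h0 D hD hf hKato
    (fun P _ => by rw [soloInformedZero_padicRegulatorOf_fin_zero]; exact one_ne_zero)

/-- **The RANK conjecture at analytic rank zero, from the joint mechanism.** Same inputs plus the
supply facts (one good ordinary `p ≥ 5`: `exists_good_ordinary_prime`; its canonical datum:
`exists_isCanonical`; the newform: `exists_isNewformOf`) and Kato at every prime:
`r_an(E) = 0 ⇒ rank E(ℚ) = 0` (globally minimal model). Known (Kolyvagin / Kato).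
[cite: MazurTateTeitelbaum1986Invent, §I.14 (14.3)] -/
theorem soloInformedZero_rank_eq_analyticRank_of_zero (hE : hasEntireLFunction_rat)
    (hOrd : WeierstrassCurve.exists_good_ordinary_prime) (hCan : exists_isCanonical)
    (hMod : exists_isNewformOf)
    (hKato : ∀ (p : ℕ) [Fact p.Prime] {N : ℕ} [NeZero N] {f : CuspForm (Gamma0 N) 2},
      kato_selmerCorank_le_order_padicLFunction W p (f := f))
    (h0 : W.analyticRank = 0) : W.mordellWeilRank = W.analyticRank := by
  obtain ⟨p, hpF, hp5, hgood, hnd⟩ := hOrd W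
  obtain ⟨D, hD⟩ := hCan W p hp5 hgood hnd
  haveI : NeZero (W.conductorNorm ℤ) := ⟨(W.conductorNorm_pos_holds).ne'⟩
  obtain ⟨f, hf⟩ := hMod W
  rw [h0]
  exact (soloInformedZero_rank_eq W hE h0 p hp5 ⟨hgood, hnd⟩ D hD f hf (hKato p)).1

/-- **The summit from the `p`-uniform receptacle with BOTH low rungs discharged.** Compared with
`soloInformedUnif_birchSwinnertonDyer`, the Gross–Zagier–Kolyvagin hypothesis is needed only at
analytic rank ONE (`r_an = 1 ⇒ rank = 1`); analytic rank zero is handled inside the mechanism by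
`soloInformedZero_unif` (interpolation) with vacuous transcendence input. Open inputs unchanged:
`(ZZ_r^u)` for `r ≥ 2` and somewhere-non-degeneracy of the canonical `p`-adic height on
Néron–Tate non-degenerate rational families. [cite: MazurTateTeitelbaum1986Invent, §I.14 (14.3)] -/
theorem soloInformedZero_birchSwinnertonDyer
    (hGZK1 : ∀ (W : WeierstrassCurve ℚ) [W.IsElliptic], W.analyticRank = 1 →
      W.mordellWeilRank = 1)
    (hE : hasEntireLFunction_rat) (hOrd : WeierstrassCurve.exists_good_ordinary_prime)
    (hCan : exists_isCanonical) (hMod : exists_isNewformOf)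
    (hKato : ∀ (W : WeierstrassCurve ℚ) [W.IsElliptic] [W.IsGloballyMinimal] (p : ℕ) [Fact p.Prime]
      {N : ℕ} [NeZero N] {f : CuspForm (Gamma0 N) 2},
      kato_selmerCorank_le_order_padicLFunction W p (f := f))
    (hZZ : ∀ r : ℕ, 2 ≤ r → JointHigherGrossZagierUnif r)
    (hS : PAdicHeightSomewhereNondegenerate) : BirchSwinnertonDyer := by
  unfold BirchSwinnertonDyer Literature.BSDRankConjecture
  intro W hW
  haveI := hW
  obtain ⟨C, hC⟩ := hasGlobalMinimalModel_rat_holds W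
  haveI := hC
  have hran : (C • W).analyticRank = W.analyticRank := analyticRank_variableChange_holds W C
  have hmw : (C • W).mordellWeilRank = W.mordellWeilRank := mordellWeilRank_variableChange_holds W C
  rw [← hran, ← hmw]
  set V := C • W with hV
  haveI : NeZero (V.conductorNorm ℤ) := ⟨(V.conductorNorm_pos_holds).ne'⟩
  obtain ⟨f, hf⟩ := hMod V
  by_cases h2 : 2 ≤ V.analyticRank
  · exact (soloInformedUnif_rank_eq V f (hZZ _ h2) hE rfl hf (fun p _ => hKato V p)
      (fun r P hP => hS V P hP)).symm
  · by_cases h1 : V.analyticRank = 1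
    · rw [h1]
      exact (hGZK1 V h1).symm
    · have h0 : V.analyticRank = 0 := by omega
      exact (soloInformedZero_rank_eq_analyticRank_of_zero V hE hOrd hCan hMod (hKato V) h0).symm

end Summit.BirchSwinnertonDyer.BirchSwinnertonDyer.Theorems

end
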